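import Summits.AtomisticToContinuum.Crystallization.Theorems.ThreeConeCertificateSlackRigidityPricedFloorsDefs
import Summits.AtomisticToContinuum.Crystallization.Theorems.PhononSlackCertificatesPeriodicGivenLayeredExtraction2
import Mathlib
import HarnessLib

/-!
# `SlackRigidity` (stmt-AtomisticToContinuum-11960), line `priced-floors-palm-exactification`:
# the layered-root event has a Giry-measurable sandwich

Worker stub `stub_layeredSandwich` of the line (lead c19).  The Palm-averaging engine integrates
the indicator of "the root is NOT `η`-layered" against point-stationary laws on `Measure E3`, which
needs a MEASURABLE event; exact measurability of `{μ | LayeredAt 2 2 η (atoms μ) 0}` is not needed,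
only a measurable `G` SANDWICHED between the `(η/2; radii 2, 2)`-layered-root event and the
`(η; radii 2, 19/10)`-layered-root event on rooted hard-core configurations `μ = count|S`.

## Proof (no compactness, no limits)

* DATA SPACE.  A layered set is parametrised by `d = (T, t, a, s, z)` in the second-countable space
  `X = (E3 →L[ℝ] E3) × E3 × ℝ × (ℤ → ℤ) × (ℤ → ℝ)`; the admissible data (`T` norm-preserving,
  `IsAdmissibleLayering a s z`) have a countable dense subset `D`.
* PROXY EVENTS.  For `d` and a tolerance `e` the event "every pattern point `p` with
  `dist p t ≤ 19/10` has `μ (closedBall (p - t) e) ≠ 0`, and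
  `μ (closedBall 0 2 \ ⋃ₚ closedBall (p - t) e) = 0`" is measurable (countably many evaluations,
  `measurableSet_prox`) and says on `count|S` exactly that `S` is `(2, 19/10; e)`-matched with the
  pattern (`count_restrict_mem_prox_iff`).  `G := ⋃_{d ∈ D} Prox d η`; the upper inclusion is
  read off.
* LOWER INCLUSION.  If `S` is `(2, 2; η/2)`-matched with the pattern of admissible data `d₀`,
  every datum `d` close to `d₀` — `dist t t₀ < γ` and the pattern points with indices in a finite
  box move by `< γ`, `γ = min (η/4) (1/20)` — has `S ∈ Prox d η`: the indices of all pattern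
  points that can enter either clause are bounded in terms of `‖t₀‖ + |z₀ 0| + η/2 + 2` alone
  (`index_bound`: heights grow linearly in the layer index, in-plane coordinates control `i, j`),
  uniformly over admissible data, and on the box the tolerances add up to `γ + η/2 + γ ≤ η`, the
  radii to `19/10 + 2γ ≤ 2`.  Density of `D` (`mem_closure_iff_frequently`) and continuity of
  finitely many pattern points in the data (`continuous_point`) provide such a `d ∈ D`.

All `[folklore]`.
-/

noncomputable section

open MeasureTheory Filter Set
open scoped ENNReal BigOperators Topology

namespace Summit.AtomisticToContinuum.Crystallization.Theorems.SlackRigidityPricedFloorsSandwich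

open Literature.Probability.Process
open Literature.MathematicalPhysics.StatisticalMechanics
open Summit.AtomisticToContinuum.Crystallization.Theorems.SlackRigidityPricedFloors
open Summit.AtomisticToContinuum.Crystallization.Theorems.LayeredHull (ext_growth
  ext_norm_layerNormal_one)

/-! ## Pre-image lattice vectors: coordinates and index bounds -/

/-- Coordinates of the pre-image lattice vector `i u(a) + j v(a) + L w(a) + h e₃`:
`(a (i + j/2 + L/2), (a√3/2) (j + L/3), h)`. [folklore] -/
theorem coord_eq (a L h : ℝ) (i j : ℤ) :
    (((i : ℝ) • triangularVec₁ a) + ((j : ℝ) • triangularVec₂ a) + (L • barlowOffset a) +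
        (h • layerNormal 1)) 0 = a * (i + j / 2 + L / 2) ∧
      (((i : ℝ) • triangularVec₁ a) + ((j : ℝ) • triangularVec₂ a) + (L • barlowOffset a) +
        (h • layerNormal 1)) 1 = a * √3 / 2 * (j + L / 3) ∧
      (((i : ℝ) • triangularVec₁ a) + ((j : ℝ) • triangularVec₂ a) + (L • barlowOffset a) +
        (h • layerNormal 1)) 2 = h := by
  simp [triangularVec₁, triangularVec₂, barlowOffset, layerNormal]
  constructor <;> ring

/-- **Index bound, uniform over admissible data.** For admissible `(a, s, z)` with `|z 0| ≤ C`, a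
pre-image lattice vector `i u(a) + j v(a) + L_s(m) w(a) + z(m) e₃` of norm `≤ C` has
`|m|, |i|, |j| ≤ ⌈5 C⌉₊` (heights grow at rate `≥ 39a/50 ≥ 7/10` per layer, `|L_s(m)| ≤ |m|`, and
the two in-plane coordinates control `j` and then `i`). [folklore] -/
theorem index_bound {a : ℝ} {s : ℤ → ℤ} {z : ℤ → ℝ} (hadm : IsAdmissibleLayering a s z) {C : ℝ}
    (hz0 : |z 0| ≤ C) {m i j : ℤ}
    (hq : ‖((i : ℝ) • triangularVec₁ a) + ((j : ℝ) • triangularVec₂ a) +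
      ((haggLabel s m : ℝ) • barlowOffset a) + (z m • layerNormal 1)‖ ≤ C) :
    |m| ≤ ⌈5 * C⌉₊ ∧ |i| ≤ ⌈5 * C⌉₊ ∧ |j| ≤ ⌈5 * C⌉₊ := by
  obtain ⟨ha, _, hs, hz⟩ := hadm
  have ha0 : 0 < a := by linarith
  have hC : 0 ≤ C := (abs_nonneg _).trans hz0
  obtain ⟨hc0, hc1, hc2⟩ := coord_eq a (haggLabel s m) (z m) i j
  have key0 := PiLp.norm_apply_le (((i : ℝ) • triangularVec₁ a) + ((j : ℝ) • triangularVec₂ a) +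
      ((haggLabel s m : ℝ) • barlowOffset a) + (z m • layerNormal 1)) 0
  have key1 := PiLp.norm_apply_le (((i : ℝ) • triangularVec₁ a) + ((j : ℝ) • triangularVec₂ a) +
      ((haggLabel s m : ℝ) • barlowOffset a) + (z m • layerNormal 1)) 1
  have key2 := PiLp.norm_apply_le (((i : ℝ) • triangularVec₁ a) + ((j : ℝ) • triangularVec₂ a) +
      ((haggLabel s m : ℝ) • barlowOffset a) + (z m • layerNormal 1)) 2
  rw [hc0, Real.norm_eq_abs] at key0
  rw [hc1, Real.norm_eq_abs] at key1
  rw [hc2, Real.norm_eq_abs] at key2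
  have hzm : |z m| ≤ C := key2.trans hq
  -- the layer index
  have hlo : (7 / 10 : ℝ) ≤ 39 / 50 * a := by linarith
  have hmR : |(m : ℝ)| ≤ 3 * C := by
    rcases le_or_gt 0 m with h0 | h0
    · obtain ⟨n, rfl⟩ := Int.eq_ofNat_of_zero_le h0
      have hg := (ext_growth hz 0 n).1
      rw [zero_add] at hg
      have hn0 : (0 : ℝ) ≤ n := n.cast_nonneg
      have h1 : (7 / 10 : ℝ) * n ≤ 39 / 50 * a * n := mul_le_mul_of_nonneg_right hlo hn0
      rw [Int.cast_natCast, Nat.abs_cast]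
      linarith [le_abs_self (z n), neg_abs_le (z 0), abs_le.1 hzm, abs_le.1 hz0]
    · obtain ⟨n, rfl⟩ := Int.exists_eq_neg_ofNat h0.le
      have hg := (ext_growth hz (-(n : ℤ)) n).1
      rw [neg_add_cancel] at hg
      have hn0 : (0 : ℝ) ≤ n := n.cast_nonneg
      have h1 : (7 / 10 : ℝ) * n ≤ 39 / 50 * a * n := mul_le_mul_of_nonneg_right hlo hn0
      rw [Int.cast_neg, Int.cast_natCast, abs_neg, Nat.abs_cast]
      linarith [le_abs_self (z 0), neg_abs_le (z (-(n : ℤ))), abs_le.1 hzm, abs_le.1 hz0]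
  -- the label: `|L_s(n)| ≤ |n|` for a `±1` word (the landed copy `GscHingeGlue.abs_haggLabel_le`
  -- lives on the `MuGroundStateConfiguration` side and cannot be imported next to the `Law*` files)
  have hlab : ∀ n : ℤ, |haggLabel s n| ≤ |n| := by
    intro n
    induction n using Int.induction_on with
    | zero => simp
    | succ n ih =>
      rw [haggLabel_succ]
      rw [Nat.abs_cast] at ih
      rw [show |(n : ℤ) + 1| = n + 1 by rw [abs_of_nonneg (by positivity)]]
      rcases hs n with h | h <;> rw [h] <;>
        cases abs_le.1 ih <;> apply abs_le.2 <;> constructor <;> linarith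
    | pred n ih =>
      have h1 := haggLabel_succ s (-(n : ℤ) - 1)
      rw [show -(n : ℤ) - 1 + 1 = -n by ring] at h1
      rw [abs_neg, Nat.abs_cast] at ih
      rw [show |-(n : ℤ) - 1| = n + 1 by
        rw [show -(n : ℤ) - 1 = -(n + 1) by ring, abs_neg, abs_of_nonneg (by positivity)]]
      rw [h1] at ih
      rcases hs (-(n : ℤ) - 1) with h | h <;> rw [h] at ih <;>
        cases abs_le.1 ih <;> apply abs_le.2 <;> constructor <;> linarith
  have hLR : |(haggLabel s m : ℝ)| ≤ 3 * C := le_trans (by exact_mod_cast hlab m) hmR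
  -- the in-plane indices
  have h3 : (17 / 10 : ℝ) ≤ √3 := (Real.le_sqrt (by norm_num) (by norm_num)).2 (by norm_num)
  have h799 : (799 / 1000 : ℝ) ≤ a * √3 / 2 := by
    nlinarith [mul_nonneg (sub_nonneg.2 ha) (sub_nonneg.2 h3)]
  have hW : 799 / 1000 * |(j : ℝ) + (haggLabel s m : ℝ) / 3| ≤ C := by
    rw [abs_mul, abs_of_pos (by positivity : (0 : ℝ) < a * √3 / 2)] at key1
    exact le_trans (mul_le_mul_of_nonneg_right h799 (abs_nonneg _)) (key1.trans hq)
  have hE : 47 / 50 * |(i : ℝ) + (j : ℝ) / 2 + (haggLabel s m : ℝ) / 2| ≤ C := by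
    rw [abs_mul, abs_of_pos ha0] at key0
    exact le_trans (mul_le_mul_of_nonneg_right ha (abs_nonneg _)) (key0.trans hq)
  have hjR : |(j : ℝ)| ≤ 3 * C := by
    obtain ⟨hL1, hL2⟩ := abs_le.1 hLR
    refine abs_le.2 ⟨?_, ?_⟩ <;>
      linarith [le_abs_self ((j : ℝ) + (haggLabel s m : ℝ) / 3),
        neg_abs_le ((j : ℝ) + (haggLabel s m : ℝ) / 3)]
  have hiR : |(i : ℝ)| ≤ 5 * C := by
    obtain ⟨hL1, hL2⟩ := abs_le.1 hLR
    obtain ⟨hj1, hj2⟩ := abs_le.1 hjR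
    refine abs_le.2 ⟨?_, ?_⟩ <;>
      linarith [le_abs_self ((i : ℝ) + (j : ℝ) / 2 + (haggLabel s m : ℝ) / 2),
        neg_abs_le ((i : ℝ) + (j : ℝ) / 2 + (haggLabel s m : ℝ) / 2)]
  have hN : 5 * C ≤ (⌈5 * C⌉₊ : ℝ) := Nat.le_ceil _
  have hcast : ∀ n : ℤ, |(n : ℝ)| ≤ 5 * C → |n| ≤ ⌈5 * C⌉₊ := fun n hn => by
    have h : ((|n| : ℤ) : ℝ) ≤ ((⌈5 * C⌉₊ : ℕ) : ℝ) := by rw [Int.cast_abs]; linarith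
    exact_mod_cast h
  exact ⟨hcast m (by linarith), hcast i hiR, hcast j (by linarith)⟩

/-! ## Continuity of a pattern point in the data -/

/-- The pattern point with indices `(m, i, j)` depends continuously on the data
`(T, t, a, s, z) ∈ (E3 →L[ℝ] E3) × E3 × ℝ × (ℤ → ℤ) × (ℤ → ℝ)` (product topology; the label
`L_s(m)` is a finite sum of coordinates of `s`). [folklore] -/
theorem continuous_point (m i j : ℤ) :
    Continuous fun d : (E3 →L[ℝ] E3) × E3 × ℝ × (ℤ → ℤ) × (ℤ → ℝ) =>
      d.1 (((i : ℝ) • triangularVec₁ d.2.2.1) + ((j : ℝ) • triangularVec₂ d.2.2.1) +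
        ((haggLabel d.2.2.2.1 m : ℝ) • barlowOffset d.2.2.1) + (d.2.2.2.2 m • layerNormal 1)) := by
  have hu : Continuous (triangularVec₁ : ℝ → E3) := by
    rw [show (triangularVec₁ : ℝ → E3) = fun a => a • triangularVec₁ 1 from funext fun a => by
      ext i; fin_cases i <;> simp [triangularVec₁]]
    exact continuous_id.smul continuous_const
  have hv : Continuous (triangularVec₂ : ℝ → E3) := by
    rw [show (triangularVec₂ : ℝ → E3) = fun a => a • triangularVec₂ 1 from funext fun a => by
      ext i; fin_cases i <;> simp [triangularVec₂] <;> ring]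
    exact continuous_id.smul continuous_const
  have hw : Continuous (barlowOffset : ℝ → E3) := by
    rw [show (barlowOffset : ℝ → E3) = fun a => a • barlowOffset 1 from funext fun a => by
      ext i; fin_cases i <;> simp [barlowOffset] <;> ring]
    exact continuous_id.smul continuous_const
  have hL : Continuous fun s : ℤ → ℤ => (haggLabel s m : ℝ) := by
    have h1 : Continuous fun s : ℤ → ℤ => haggLabel s m := by
      unfold haggLabel haggWindow
      split_ifs
      · exact continuous_finsetSum (Finset.range _) fun i _ =>
          continuous_apply ((0 : ℤ) + (i : ℤ))
      · exact (continuous_finsetSum (Finset.range _) fun i _ =>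
          continuous_apply (m + (i : ℤ))).neg
    exact continuous_of_discreteTopology.comp h1
  have ha : Continuous fun d : (E3 →L[ℝ] E3) × E3 × ℝ × (ℤ → ℤ) × (ℤ → ℝ) => d.2.2.1 := by
    fun_prop
  have hs : Continuous fun d : (E3 →L[ℝ] E3) × E3 × ℝ × (ℤ → ℤ) × (ℤ → ℝ) =>
      (haggLabel d.2.2.2.1 m : ℝ) := hL.comp (by fun_prop)
  have hz : Continuous fun d : (E3 →L[ℝ] E3) × E3 × ℝ × (ℤ → ℤ) × (ℤ → ℝ) => d.2.2.2.2 m :=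
    (continuous_apply m).comp (by fun_prop)
  have hq : Continuous fun d : (E3 →L[ℝ] E3) × E3 × ℝ × (ℤ → ℤ) × (ℤ → ℝ) =>
      ((i : ℝ) • triangularVec₁ d.2.2.1) + ((j : ℝ) • triangularVec₂ d.2.2.1) +
        ((haggLabel d.2.2.2.1 m : ℝ) • barlowOffset d.2.2.1) + (d.2.2.2.2 m • layerNormal 1) :=
    ((((hu.comp ha).const_smul (i : ℝ)).add ((hv.comp ha).const_smul (j : ℝ))).add
      (hs.smul (hw.comp ha))).add (hz.smul continuous_const)
  exact continuous_fst.clm_apply hq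

/-! ## Proxy events -/

/-- **The proxy event is Giry-measurable**: for a countable family of centres `f k - t`, the set of
measures charging every ball `closedBall (f k - t) e` with `dist (f k) t ≤ 19/10` and not charging
`closedBall 0 2` off all the balls is measurable (countably many evaluations `μ ↦ μ B`).
[folklore] -/
theorem measurableSet_prox (f : ℤ × ℤ × ℤ → E3) (t : E3) (e : ℝ) :
    MeasurableSet {μ : Measure E3 |
      (∀ k, dist (f k) t ≤ 19 / 10 → μ (Metric.closedBall (f k - t) e) ≠ 0) ∧
        μ (Metric.closedBall 0 2 \ ⋃ k, Metric.closedBall (f k - t) e) = 0} := by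
  have hU : MeasurableSet (⋃ k, Metric.closedBall (f k - t) e) :=
    MeasurableSet.iUnion fun k => Metric.isClosed_closedBall.measurableSet
  rw [Set.setOf_and]
  refine MeasurableSet.inter ?_
    (Measure.measurable_coe (Metric.isClosed_closedBall.measurableSet.diff hU)
      (measurableSet_singleton 0))
  rw [Set.setOf_forall]
  refine MeasurableSet.iInter fun k => MeasurableSet.imp (MeasurableSet.const _) ?_
  exact (Measure.measurable_coe Metric.isClosed_closedBall.measurableSet
    (measurableSet_singleton 0)).compl

/-- **Proxy event on a counting measure.** For `μ = count|S` the proxy event says exactly: every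
centre `f k` with `dist (f k) t ≤ 19/10` has a point `x ∈ S` with `dist (x + t) (f k) ≤ e`, and
every `x ∈ S` with `‖x‖ ≤ 2` has a centre with `dist (x + t) (f k) ≤ e`. [folklore] -/
theorem count_restrict_mem_prox_iff (f : ℤ × ℤ × ℤ → E3) (t : E3) (e : ℝ) (S : Set E3) :
    ((∀ k, dist (f k) t ≤ 19 / 10 →
        (Measure.count : Measure E3).restrict S (Metric.closedBall (f k - t) e) ≠ 0) ∧
      (Measure.count : Measure E3).restrict S
        (Metric.closedBall 0 2 \ ⋃ k, Metric.closedBall (f k - t) e) = 0) ↔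
    (∀ k, dist (f k) t ≤ 19 / 10 → ∃ x ∈ S, dist (x + t) (f k) ≤ e) ∧
      (∀ x ∈ S, ‖x‖ ≤ 2 → ∃ k, dist (x + t) (f k) ≤ e) := by
  have hU : MeasurableSet (⋃ k, Metric.closedBall (f k - t) e) :=
    MeasurableSet.iUnion fun k => Metric.isClosed_closedBall.measurableSet
  have hd : ∀ x k, x ∈ Metric.closedBall (f k - t) e ↔ dist (x + t) (f k) ≤ e := fun x k => by
    rw [Metric.mem_closedBall, dist_eq_norm, dist_eq_norm, sub_sub_eq_add_sub]
  refine and_congr (forall_congr' fun k => imp_congr_right fun _ => ?_) ?_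
  · rw [Measure.restrict_apply Metric.isClosed_closedBall.measurableSet,
      Measure.count_ne_zero_iff]
    exact ⟨fun ⟨x, hx, hxS⟩ => ⟨x, hxS, (hd x k).1 hx⟩, fun ⟨x, hxS, hx⟩ => ⟨x, (hd x k).2 hx, hxS⟩⟩
  · rw [Measure.restrict_apply (Metric.isClosed_closedBall.measurableSet.diff hU),
      Measure.count_eq_zero_iff, Set.eq_empty_iff_forall_notMem]
    constructor
    · intro h x hx hx2
      by_contra hex
      refine h x ⟨⟨mem_closedBall_zero_iff.2 hx2, fun hxU => hex ?_⟩, hx⟩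
      obtain ⟨k, hk⟩ := Set.mem_iUnion.1 hxU
      exact ⟨k, (hd x k).1 hk⟩
    · rintro h x ⟨⟨hx2, hxU⟩, hx⟩
      obtain ⟨k, hk⟩ := h x hx (mem_closedBall_zero_iff.1 hx2)
      exact hxU (Set.mem_iUnion.2 ⟨k, (hd x k).2 hk⟩)

/-- `‖u‖ ≤ ‖v‖ + dist u v`. [folklore] -/
theorem norm_le_norm_add_dist (u v : E3) : ‖u‖ ≤ ‖v‖ + dist u v := by
  rw [dist_eq_norm]; exact norm_le_norm_add_norm_sub' u v

/-! ## The sandwich -/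

/-- **The layered-root event has a measurable sandwich** (registered stub `stub_layeredSandwich`
of the line `priced-floors-palm-exactification`): for `δ, η > 0` there is a Giry-measurable
`G ⊆ Measure E3` such that, on rooted `δ`-hard-core configurations, `LayeredAt 2 2 (η/2)` at the
root implies `μ ∈ G`, and `μ ∈ G` implies `LayeredAt 2 (19/10) η` at the root (`G` = countable
union of proxy events over a countable dense set of admissible data). [folklore] -/
theorem stub_layeredSandwich : ∀ δ η : ℝ, 0 < δ → 0 < η → ∃ G : Set (Measure E3), MeasurableSet G ∧ (∀ μ : Measure E3, IsRootedHardCore δ μ → μ ∈ G → LayeredAt 2 (19 / 10) η (atoms μ) 0) ∧ (∀ μ : Measure E3, IsRootedHardCore δ μ → LayeredAt 2 2 (η / 2) (atoms μ) 0 → μ ∈ G) := by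
  intro δ η _hδ hη
  -- admissible data and a countable dense subset
  set Adm : Set ((E3 →L[ℝ] E3) × E3 × ℝ × (ℤ → ℤ) × (ℤ → ℝ)) :=
    {d | (∀ v, ‖d.1 v‖ = ‖v‖) ∧ IsAdmissibleLayering d.2.2.1 d.2.2.2.1 d.2.2.2.2}
  obtain ⟨D, hDA, hDc, hAD⟩ :=
    (TopologicalSpace.IsSeparable.of_separableSpace Adm).exists_countable_dense_subset
  -- the pattern point map
  set pt : (E3 →L[ℝ] E3) × E3 × ℝ × (ℤ → ℤ) × (ℤ → ℝ) → ℤ × ℤ × ℤ → E3 := fun d k =>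
    d.1 (((k.2.1 : ℝ) • triangularVec₁ d.2.2.1) + ((k.2.2 : ℝ) • triangularVec₂ d.2.2.1) +
      ((haggLabel d.2.2.2.1 k.1 : ℝ) • barlowOffset d.2.2.1) + (d.2.2.2.2 k.1 • layerNormal 1))
  refine ⟨⋃ d ∈ D, {μ : Measure E3 |
      (∀ k, dist (pt d k) d.2.1 ≤ 19 / 10 → μ (Metric.closedBall (pt d k - d.2.1) η) ≠ 0) ∧
        μ (Metric.closedBall 0 2 \ ⋃ k, Metric.closedBall (pt d k - d.2.1) η) = 0},
    MeasurableSet.biUnion hDc fun d _ => measurableSet_prox (pt d) d.2.1 η, ?_, ?_⟩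
  · -- upper inclusion: read off the proxy
    rintro μ ⟨S, -, -, rfl⟩ hG
    rw [atoms_count_restrict]
    simp only [mem_iUnion, exists_prop] at hG
    obtain ⟨d, hdD, hdP⟩ := hG
    rw [mem_setOf_eq, count_restrict_mem_prox_iff] at hdP
    obtain ⟨hT, hadm⟩ := hDA hdD
    let A : E3 →ₗᵢ[ℝ] E3 := { toLinearMap := (d.1 : E3 →ₗ[ℝ] E3), norm_map' := hT }
    refine ⟨A, d.2.1, d.2.2.1, d.2.2.2.1, d.2.2.2.2, hadm, fun x hx hx2 => ?_, ?_⟩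
    · rw [dist_zero_right] at hx2
      obtain ⟨k, hk⟩ := hdP.2 x hx hx2
      exact ⟨pt d k, ⟨k.1, k.2.1, k.2.2, rfl⟩, hk⟩
    · rintro p ⟨m, i, j, rfl⟩ hp
      rw [zero_add] at hp
      exact hdP.1 (m, i, j) hp
  · -- lower inclusion: density
    rintro μ ⟨S, -, -, rfl⟩ hL
    rw [atoms_count_restrict] at hL
    obtain ⟨A, t, a, s, z, hadm, hS, hP⟩ := hL
    set d₀ : (E3 →L[ℝ] E3) × E3 × ℝ × (ℤ → ℤ) × (ℤ → ℝ) := (A.toContinuousLinearMap, t, a, s, z)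
    have hd₀A : d₀ ∈ Adm := ⟨fun v => A.norm_map v, hadm⟩
    have hpt₀ : ∀ k : ℤ × ℤ × ℤ, pt d₀ k = A (((k.2.1 : ℝ) • triangularVec₁ a) +
        ((k.2.2 : ℝ) • triangularVec₂ a) + ((haggLabel s k.1 : ℝ) • barlowOffset a) +
        (z k.1 • layerNormal 1)) := fun k => rfl
    -- constants
    set γ : ℝ := min (η / 4) (1 / 20) with hγ
    have hγ0 : 0 < γ := lt_min (by positivity) (by norm_num)
    obtain ⟨hγη, hγ1⟩ : γ ≤ η / 4 ∧ γ ≤ 1 / 20 := ⟨min_le_left _ _, min_le_right _ _⟩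
    set C : ℝ := ‖t‖ + |z 0| + η / 2 + 2 with hC
    have hz0C : |z 0| ≤ C := by rw [hC]; linarith [norm_nonneg t]
    set N : ℕ := ⌈5 * C⌉₊ with hN
    set Box : Finset (ℤ × ℤ × ℤ) :=
      (Finset.Icc (-(N : ℤ)) N) ×ˢ ((Finset.Icc (-(N : ℤ)) N) ×ˢ (Finset.Icc (-(N : ℤ)) N))
      with hBox
    have hmemBox : ∀ k : ℤ × ℤ × ℤ, |k.1| ≤ N ∧ |k.2.1| ≤ N ∧ |k.2.2| ≤ N → k ∈ Box := by
      rintro ⟨m, i, j⟩ ⟨hm, hi, hj⟩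
      simp only [hBox, Finset.mem_product, Finset.mem_Icc]
      exact ⟨abs_le.1 hm, abs_le.1 hi, abs_le.1 hj⟩
    -- the neighbourhood of `d₀` and an element of `D` in it
    have hV : ∀ᶠ d in 𝓝 d₀, dist d.2.1 t < γ ∧ ∀ k ∈ Box, dist (pt d k) (pt d₀ k) < γ := by
      refine Eventually.and ?_ ((eventually_all_finset Box).2 fun k _ => ?_)
      · have hc : Continuous fun d : (E3 →L[ℝ] E3) × E3 × ℝ × (ℤ → ℤ) × (ℤ → ℝ) => d.2.1 := by
          fun_prop
        exact (hc.tendsto d₀).eventually (Metric.ball_mem_nhds _ hγ0)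
      · exact ((continuous_point k.1 k.2.1 k.2.2).tendsto d₀).eventually
          (Metric.ball_mem_nhds _ hγ0)
    obtain ⟨d, hdD, hdt, hdk⟩ :=
      ((mem_closure_iff_frequently.1 (hAD hd₀A)).and_eventually hV).exists
    obtain ⟨hT, hadm'⟩ := hDA hdD
    refine mem_iUnion₂.2 ⟨d, hdD, ?_⟩
    rw [mem_setOf_eq, count_restrict_mem_prox_iff]
    have hnorm_pt : ∀ k : ℤ × ℤ × ℤ, ‖pt d k‖ = ‖((k.2.1 : ℝ) • triangularVec₁ d.2.2.1) +
        ((k.2.2 : ℝ) • triangularVec₂ d.2.2.1) +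
        ((haggLabel d.2.2.2.1 k.1 : ℝ) • barlowOffset d.2.2.1) +
        (d.2.2.2.2 k.1 • layerNormal 1)‖ := fun k => hT _
    have hdt2 : ‖d.2.1‖ ≤ ‖t‖ + γ := (norm_le_norm_add_dist _ _).trans (by linarith [hdt.le])
    -- the height of layer `0` of `d`
    have hz0' : |d.2.2.2.2 0| ≤ C := by
      have h1 := hdk _ (hmemBox ((0 : ℤ), (0 : ℤ), (0 : ℤ)) ⟨by simp, by simp, by simp⟩)
      have e1 : ‖pt d (0, 0, 0)‖ = |d.2.2.2.2 0| := by
        rw [hnorm_pt]; simp [norm_smul, ext_norm_layerNormal_one]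
      have e0 : ‖pt d₀ (0, 0, 0)‖ = |z 0| := by
        rw [hpt₀, A.norm_map]; simp [norm_smul, ext_norm_layerNormal_one]
      have h2 := norm_le_norm_add_dist (pt d (0, 0, 0)) (pt d₀ (0, 0, 0))
      rw [e1, e0] at h2
      rw [hC]; linarith [h1.le, norm_nonneg t]
    constructor
    · -- pattern side
      intro k hk
      have hnk : ‖((k.2.1 : ℝ) • triangularVec₁ d.2.2.1) +
          ((k.2.2 : ℝ) • triangularVec₂ d.2.2.1) +
          ((haggLabel d.2.2.2.1 k.1 : ℝ) • barlowOffset d.2.2.1) +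
          (d.2.2.2.2 k.1 • layerNormal 1)‖ ≤ C := by
        rw [← hnorm_pt]
        have h1 := norm_le_norm_add_dist (pt d k) d.2.1
        rw [hC]; linarith [abs_nonneg (z 0)]
      obtain ⟨hm, hi, hj⟩ := index_bound hadm' hz0' hnk
      have hdk' := hdk k (hmemBox k ⟨hm, hi, hj⟩)
      have h2 : dist (pt d₀ k) (0 + t) ≤ 2 := by
        rw [zero_add]
        calc dist (pt d₀ k) t ≤ dist (pt d₀ k) (pt d k) + dist (pt d k) d.2.1 + dist d.2.1 t :=
              dist_triangle4 _ _ _ _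
          _ ≤ γ + 19 / 10 + γ := add_le_add_three (by rw [dist_comm]; exact hdk'.le) hk hdt.le
          _ ≤ 2 := by linarith
      obtain ⟨x, hx, hxd⟩ := hP (pt d₀ k) ⟨k.1, k.2.1, k.2.2, hpt₀ k⟩ h2
      refine ⟨x, hx, ?_⟩
      calc dist (x + d.2.1) (pt d k)
          ≤ dist (x + d.2.1) (x + t) + dist (x + t) (pt d₀ k) + dist (pt d₀ k) (pt d k) :=
            dist_triangle4 _ _ _ _
        _ ≤ γ + η / 2 + γ :=
            add_le_add_three (by rw [dist_add_left]; exact hdt.le) hxd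
              (by rw [dist_comm]; exact hdk'.le)
        _ ≤ η := by linarith
    · -- configuration side
      intro x hx hx2
      obtain ⟨p, ⟨m, i, j, rfl⟩, hpd⟩ := hS x hx (by rwa [dist_zero_right])
      have hnk : ‖((i : ℝ) • triangularVec₁ a) + ((j : ℝ) • triangularVec₂ a) +
          ((haggLabel s m : ℝ) • barlowOffset a) + (z m • layerNormal 1)‖ ≤ C := by
        rw [← A.norm_map]
        have h1 := norm_le_norm_add_dist (A (((i : ℝ) • triangularVec₁ a) +
          ((j : ℝ) • triangularVec₂ a) + ((haggLabel s m : ℝ) • barlowOffset a) +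
          (z m • layerNormal 1))) (x + t)
        rw [dist_comm] at h1
        have h2 : ‖x + t‖ ≤ ‖x‖ + ‖t‖ := norm_add_le _ _
        rw [hC]; linarith [abs_nonneg (z 0)]
      obtain ⟨hm, hi, hj⟩ := index_bound hadm hz0C hnk
      have hdk' := hdk (m, i, j) (hmemBox _ ⟨hm, hi, hj⟩)
      refine ⟨(m, i, j), ?_⟩
      calc dist (x + d.2.1) (pt d (m, i, j))
          ≤ dist (x + d.2.1) (x + t) + dist (x + t) (pt d₀ (m, i, j)) +
              dist (pt d₀ (m, i, j)) (pt d (m, i, j)) := dist_triangle4 _ _ _ _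
        _ ≤ γ + η / 2 + γ :=
            add_le_add_three (by rw [dist_add_left]; exact hdt.le) hpd
              (by rw [dist_comm]; exact hdk'.le)
        _ ≤ η := by linarith

end Summit.AtomisticToContinuum.Crystallization.Theorems.SlackRigidityPricedFloorsSandwich

end
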